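import Summits.QuantumFields.BalabanUV.Beta.AveragingLinearGaugeVH

/-!
# `BalabanUV.Beta.GAN24.VHClassCurrentSym` — binder row G-an2-4 ∕ (CONV-C), W-slot CT-W, conservation law (C)∕(C)sym AT ALL LEVELS, THE «VH LETTER» of this lineage's note
# `HOME/b2b-balaban-gan24-formalise-leaf-04/g68/EXIT-FACE-CURRENT-TOWER.md` §2 (I6): **THE SLOT↔LEG-SYMMETRISED TWO-DATUM CONTRACTION OF THE ROOTED BORDER TABLE `vhSAt ρ d L`
# VANISHES FOR EXIT-FACE-SUPPORTED SINGLE-COORDINATE DATA** — for `h`, `s : ℤ → ℝ` supported on `{n : n % L = L − 1}`, every multiplier∕field free leg `(p, a)`: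
# `Σ'_q h(q_β)·Σ'_u s(u_ν)·vhSAt ρ d L ν u q p (inl β) a + Σ'_q s(q_ν)·Σ'_u h(u_β)·vhSAt ρ d L β u q p (inl ν) a = 0`.

NOT IN PRINT; OUR BOOKKEEPING ([folklore] finite algebra over an1's DEFINITIONS BY NAME: `AveragingHessianKernelsRooted.vhSAt ∕ vhKerAt ∕ vhCountAt ∕ linCountAt ∕ linKerAt ∕
hessCountAt_swap ∕ linAvgAt_single ∕ lettersIn_gammaCAt ∕ vhKerAt_eq_zero_left ∕ _right ∕ linKerAt_eq_zero`, `AveragingContoursRooted.linAvgAt ∕ linAvgAt_sub ∕ linAvgAt_grad`,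
`LinearGaugeVH.nearBox ∕ mem_nearBox`; G-an2-4 formalisation swarm, leaf prover `b2b-balaban-gan24-formalise-leaf-04`, gen 69).  HONEST FRAMING (cell contract, verbatim):
«discharging `BetaPertH` makes Bałaban's UV stability UNCONDITIONAL — a real constructive-QFT result; it is NOT the continuum limit and NOT the Clay problem.»  HONEST DEPENDENCY
(verbatim): «continuum YM on T⁴ ⇐ BetaPertH ∧ nine spine estimates (0/9 proved); BetaPertH ⇐ (D1) ∧ (D4) ∧ CAP+tail; G-an2-4 gates asym, D1 and NE2/3/4.»

WHY.  The (A)-tower of the note («`S_j(a; ·; b) + S_j(b; ·; a) = 0` for class data, all first legs») — the input of the level-`j` response-word cancellation (L3c)_j (twin of 40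
`RespWordsLevelZero`) — descends through the cubic sector exactly like the (D)-tower (`ExitFaceCurrentTowerStep`), but one level down it meets MULTIPLIER free legs, where only the
border sector `vhSAt ρ` lives.  Its symmetrised kernel is `m^ρ_b(f,f′) + m^ρ_b(f′,f) = [f = f′]·q¹_b(f) − q¹_b(f)·q¹_b(f′)` (the antisymmetric W-Hessian `h^ρ_b` drops:
`hessCountAt_swap`), and against single-coordinate forms `q¹_b` is a WINDOW SUM (every single-coordinate one-form is exact on the support box, `linAvgAt_grad`):
`Σ_q g(q_β)·q¹_{(m,y)}(β,q) = [β = m]·Σ_{k<L} g(L·y_m + ρ_m + k)`.  For data supported on the exit faces `n ≡ −1 (mod L)` the window holds ONE point, so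
`W(hs) − W(h)·W(s) = h(n⋆)s(n⋆) − h(n⋆)s(n⋆) = 0` (ENGINE, this lineage's g68 kit j197794 `probe_antisym.py`, D = 2, n = 3: the VH multiplier-leg current of the dressed exit-face data is
`5·10⁻¹⁵` at level 1, `8·10⁻¹⁶` at level 0 — weight 0, decides nothing here).  Face-supportedness is NECESSARY: for general class data `c + dΦ` and `β = ν ≠ m` the window sum
`W(hs) − W(h)W(s)` does not vanish.

WHAT ([folklore]; generic `d`, `1 ≤ L`, in-block root `r ∈ box L`; 0 `def`, 0 cited facts, 0 `def … : Prop`, 0 sorry): §1 `linAvgAt_zero'`, `linAvgAt_add'`, `linAvgAt_finset_sum`,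
`linAvgAt_eq_zero_of_near`, `linAvgAt_congr_near` (the rooted linear averaging only reads the support box); §2 `linAvgAt_eq_sum_nearBox` (kernel representation
`linAvgAt ρ A = Σ_{x ∈ nearBox} Σ_κ q¹(κ,x)·A κ x`); §3 `linAvgAt_coordForm` (single-coordinate forms: `[β = m]·L^{d+1}·Σ_{k<L} g(L·y_m + r_m + k)`),
`sum_nearBox_mul_linKerAt`; §4 `vhKerAt_add_swap`; §5 `emod_window`, `sum_range_face`, `sum_nearBox_vhKerAt_symm_eq_zero`; §6 **`vhSAt_classCurrent_add_swap_eq_zero`** (weighted leg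
first, free leg `(p, a)` second) and **`vhSAt_classCurrent_add_swap_eq_zero'`** (free leg first).  Asserts NO value of Bałaban's tables beyond an1's DEFINED `vhSAt`; discharges NOTHING of
(C)sym ∕ (Q-D) ∕ (Q-D-rate) ∕ «T2Shape» ∕ «T2Drift» ∕ (hW, hWall); NEVER «G-an2-4 closed» as (CONV-C); NOT D1, NOT `BetaPertH`, NOT continuum, NOT Clay.  2026-08-23; no existing file touched.
-/

noncomputable section

open Finset
open scoped BigOperators
open Literature.MathematicalPhysics.QuantumFieldTheory.Balaban1983to89
open Literature.MathematicalPhysics.QuantumFieldTheory.Balaban1983to89.Beta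
open AffineAveraging AveragingContours AveragingContoursRooted AveragingHessianKernels AveragingHessianKernelsRooted
open OneStepResolventKernel (Fib)
open Summit.QuantumFields.BalabanUV.Beta.LinearGaugeVH (nearBox mem_nearBox)

namespace Summit.QuantumFields.BalabanUV.Beta.GAN24.VHClassCurrentSym

variable {d : ℕ}

/-! ## §1 The rooted linear averaging is additive and only reads the support box -/

section LinAvg

variable {D : ℕ}

/-- [folklore] `linAvgAt ρ 0 = 0`. -/
theorem linAvgAt_zero' (ρ : Site D) (L : ℕ) (μ : Fin D) (y : Site D) : linAvgAt ρ (0 : Form1 D ℝ) L μ y = 0 := by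
  have h := linAvgAt_sub ρ (0 : Form1 D ℝ) 0 L μ y
  rwa [sub_zero, sub_self] at h

/-- [folklore] Additivity of `linAvgAt` in the one-form. -/
theorem linAvgAt_add' (ρ : Site D) (A B : Form1 D ℝ) (L : ℕ) (μ : Fin D) (y : Site D) :
    linAvgAt ρ (A + B) L μ y = linAvgAt ρ A L μ y + linAvgAt ρ B L μ y := by
  have h := linAvgAt_sub ρ (A + B) B L μ y
  rw [add_sub_cancel_right] at h
  linarith

/-- [folklore] Finite additivity of `linAvgAt` in the one-form. -/
theorem linAvgAt_finset_sum {ι : Type*} (ρ : Site D) (s : Finset ι) (A : ι → Form1 D ℝ) (L : ℕ) (μ : Fin D) (y : Site D) :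
    linAvgAt ρ (∑ i ∈ s, A i) L μ y = ∑ i ∈ s, linAvgAt ρ (A i) L μ y := by
  classical
  induction s using Finset.induction_on with
  | empty => rw [Finset.sum_empty, Finset.sum_empty, linAvgAt_zero']
  | insert _ _ hi ih => rw [Finset.sum_insert hi, Finset.sum_insert hi, linAvgAt_add', ih]

/-- [folklore] A one-form vanishing on every bond based in the support box `Near L y` has zero rooted average (in-block root). -/
theorem linAvgAt_eq_zero_of_near {L : ℕ} {r : Fin D → ℕ} (hr : r ∈ box D L) {A : Form1 D ℝ} (μ : Fin D) (y : Site D)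
    (hA : ∀ κ x, Near L y x → A κ x = 0) : linAvgAt (toSite r) A L μ y = 0 := by
  rw [linAvgAt]
  refine Finset.sum_eq_zero fun b hb => List.sum_eq_zero fun a ha => ?_
  obtain ⟨κ, x, hx, h⟩ := lettersIn_gammaCAt A L μ y hr hb a ha
  rcases h with h | h
  · rw [h, hA κ x hx]
  · rw [h, hA κ x hx, neg_zero]

/-- [folklore] Two one-forms agreeing on the support box have the same rooted average (in-block root). -/
theorem linAvgAt_congr_near {L : ℕ} {r : Fin D → ℕ} (hr : r ∈ box D L) {A A' : Form1 D ℝ} (μ : Fin D) (y : Site D)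
    (h : ∀ κ x, Near L y x → A κ x = A' κ x) : linAvgAt (toSite r) A L μ y = linAvgAt (toSite r) A' L μ y := by
  have h0 := linAvgAt_eq_zero_of_near hr μ y (A := A - A') (fun κ x hx => by rw [Pi.sub_apply, Pi.sub_apply, h κ x hx, sub_self])
  rwa [linAvgAt_sub, sub_eq_zero] at h0

end LinAvg

/-! ## §2 Kernel representation of the rooted average on the support box -/

section Kernel

/-- [folklore] **`linAvgAt ρ A = Σ_{x ∈ nearBox L y} Σ_κ q¹(κ, x)·A κ x`** (in-block root; `q¹ = linCountAt`, an1's `linAvgAt_single`). -/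
theorem linAvgAt_eq_sum_nearBox {L : ℕ} {r : Fin (d + 1) → ℕ} (hr : r ∈ box (d + 1) L) (A : Form1 (d + 1) ℝ) (μ : Fin (d + 1))
    (y : Site (d + 1)) :
    linAvgAt (toSite r) A L μ y = ∑ x ∈ nearBox L y, ∑ κ : Fin (d + 1), (linCountAt (toSite r) L μ y (κ, x) : ℝ) * A κ x := by
  classical
  have hagree : ∀ κ x, Near L y x → A κ x = (∑ x' ∈ nearBox L y, ∑ κ' : Fin (d + 1), single (κ', x') (A κ' x')) κ x := by
    intro κ x hx
    rw [Finset.sum_apply, Finset.sum_apply]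
    simp only [Finset.sum_apply, single_apply, Prod.mk.injEq]
    rw [Finset.sum_eq_single x]
    · rw [Finset.sum_eq_single κ]
      · simp
      · intro κ' _ hκ'
        rw [if_neg fun h => hκ' h.1.symm]
      · intro h; exact absurd (Finset.mem_univ κ) h
    · intro x' _ hx'
      exact Finset.sum_eq_zero fun κ' _ => by rw [if_neg fun h => hx' h.2.symm]
    · intro h; exact absurd (mem_nearBox.2 hx) h
  rw [linAvgAt_congr_near hr μ y hagree, linAvgAt_finset_sum]
  refine Finset.sum_congr rfl fun x _ => ?_
  rw [linAvgAt_finset_sum]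
  refine Finset.sum_congr rfl fun κ _ => ?_
  rw [linAvgAt_single, zsmul_eq_mul]

end Kernel

/-! ## §3 Single-coordinate one-forms: the rooted average is a window sum -/

section Coord

/-- [folklore] **THE ROOTED AVERAGE OF A SINGLE-COORDINATE ONE-FORM** `(κ, x) ↦ [κ = β]·g(x_β)` over the coarse bond `(m, y)` (in-block root `r`):
`[β = m]·L^{d+1}·Σ_{k<L} g(L·y_m + r_m + k)` — every single-coordinate form is exact on the support box (`linAvgAt_grad`). -/
theorem linAvgAt_coordForm {L : ℕ} {r : Fin (d + 1) → ℕ} (hr : r ∈ box (d + 1) L) (g : ℤ → ℝ) (β m : Fin (d + 1)) (y : Site (d + 1)) :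
    linAvgAt (toSite r) (fun κ x => if κ = β then g (x β) else 0) L m y =
      if β = m then ((L : ℝ) ^ (d + 1)) * ∑ k ∈ Finset.range L, g ((L : ℤ) * y m + (r m : ℤ) + (k : ℤ)) else 0 := by
  classical
  -- antiderivative along the `β`-coordinate, based at `L·y_β`
  set G : Site (d + 1) → ℝ := fun x => ∑ k ∈ Finset.range (x β - (L : ℤ) * y β).toNat, g ((L : ℤ) * y β + (k : ℤ)) with hG
  have hagree : ∀ κ x, Near L y x → (if κ = β then g (x β) else 0) = grad G κ x := by
    intro κ x hx
    have hxβ : (L : ℤ) * y β ≤ x β := (hx β).1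
    rw [grad]
    by_cases hκ : κ = β
    · subst hκ
      rw [if_pos rfl, hG]
      simp only [Pi.add_apply, unitVec_apply, if_true]
      rw [show (x κ + 1 - (L : ℤ) * y κ).toNat = (x κ - (L : ℤ) * y κ).toNat + 1 by omega, Finset.sum_range_succ, add_sub_cancel_left]
      congr 1
      omega
    · rw [if_neg hκ, hG]
      simp only [Pi.add_apply, unitVec_apply, if_neg (Ne.symm hκ), add_zero, sub_self]
  -- `#box = L^{d+1}` (the count is `Literature.Algebra.EuclideanLattices.Regev2004.card_box`; kept local as in an2's `AffineAveraging`, to avoid an unrelated import)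
  have hcard : (box (d + 1) L).card = L ^ (d + 1) := by
    simp [AffineAveraging.box, Fintype.card_piFinset, Finset.card_range, Finset.prod_const, Finset.card_univ, Fintype.card_fin]
  rw [linAvgAt_congr_near hr m y hagree, linAvgAt_grad, hcard, nsmul_eq_mul, Nat.cast_pow]
  have hrm : ∀ i, r i < L := by simpa [AffineAveraging.box, Fintype.mem_piFinset, Finset.mem_range] using hr
  by_cases hβ : β = m
  · subst hβ
    rw [if_pos rfl, hG]
    simp only [Pi.add_apply, Pi.smul_apply, smul_eq_mul, toSite, unitVec_apply, if_true, mul_one]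
    rw [show ((L : ℤ) * y β + (r β : ℤ) + (L : ℤ) - (L : ℤ) * y β).toNat = r β + L by omega,
      show ((L : ℤ) * y β + (r β : ℤ) - (L : ℤ) * y β).toNat = r β by omega, Finset.sum_range_add, add_sub_cancel_left]
    congr 1
    refine Finset.sum_congr rfl fun k _ => ?_
    push_cast
    ring_nf
  · rw [if_neg hβ, hG]
    simp only [Pi.add_apply, Pi.smul_apply, smul_eq_mul, toSite, unitVec_apply, if_neg hβ, mul_zero, add_zero, sub_self, mul_zero]

/-- [folklore] **THE WINDOW SUM**: `Σ_{q ∈ nearBox L y} g(q_β)·q¹_{(m,y)}(β,q) = [β = m]·Σ_{k<L} g(L·y_m + r_m + k)` (`q¹ = linKerAt`, in-block root). -/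
theorem sum_nearBox_mul_linKerAt {L : ℕ} (hL : 1 ≤ L) {r : Fin (d + 1) → ℕ} (hr : r ∈ box (d + 1) L) (g : ℤ → ℝ) (β m : Fin (d + 1))
    (y : Site (d + 1)) :
    ∑ q ∈ nearBox L y, g (q β) * linKerAt (toSite r) L m y (β, q) =
      if β = m then ∑ k ∈ Finset.range L, g ((L : ℤ) * y m + (r m : ℤ) + (k : ℤ)) else 0 := by
  classical
  have hLD : (0 : ℝ) < (L : ℝ) ^ (d + 1) := by positivity
  have h := linAvgAt_eq_sum_nearBox hr (fun κ x => if κ = β then g (x β) else 0) m y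
  rw [linAvgAt_coordForm hr g β m y] at h
  have e : ∑ x ∈ nearBox L y, ∑ κ : Fin (d + 1), (linCountAt (toSite r) L m y (κ, x) : ℝ) * (if κ = β then g (x β) else 0) =
      (L : ℝ) ^ (d + 1) * ∑ q ∈ nearBox L y, g (q β) * linKerAt (toSite r) L m y (β, q) := by
    rw [Finset.mul_sum]
    refine Finset.sum_congr rfl fun x _ => ?_
    rw [Finset.sum_eq_single β (fun κ _ hκ => by rw [if_neg hκ, mul_zero]) (fun h => absurd (Finset.mem_univ β) h), if_pos rfl, linKerAt]
    symm
    rw [mul_div_assoc', mul_div_assoc', mul_div_cancel_left₀ _ hLD.ne', mul_comm]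
  rw [e] at h
  split_ifs at h with hβ
  · rw [if_pos hβ]
    exact mul_left_cancel₀ hLD.ne' h.symm
  · rw [if_neg hβ]
    have := h.symm
    rwa [mul_eq_zero, or_iff_right hLD.ne'] at this

end Coord

/-! ## §4 The symmetrised border kernel -/

section Kernel2

/-- [folklore] **`m^ρ_b(f,f′) + m^ρ_b(f′,f) = [f = f′]·q¹_b(f) − q¹_b(f)·q¹_b(f′)`** (`vhCountAt = L^D·hessCountAt + L^D·[f=f′]·linCountAt − linCountAt⊗linCountAt`, the
antisymmetric `hessCountAt` drops). -/
theorem vhKerAt_add_swap {D : ℕ} {L : ℕ} (hL : 1 ≤ L) (ρ : Fin D → ℤ) (μ : Fin D) (y : Fin D → ℤ) (f f' : Bond D) :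
    vhKerAt ρ L μ y f f' + vhKerAt ρ L μ y f' f = (if f = f' then linKerAt ρ L μ y f else 0) - linKerAt ρ L μ y f * linKerAt ρ L μ y f' := by
  have hL0 : (L : ℝ) ≠ 0 := by exact_mod_cast (Nat.one_le_iff_ne_zero.mp hL)
  rw [vhKerAt, vhKerAt, vhCountAt, vhCountAt, hessCountAt_swap ρ L μ y f f', linKerAt, linKerAt]
  by_cases hf : f = f'
  · subst hf
    simp only [if_true]
    push_cast
    field_simp
    ring
  · rw [if_neg hf, if_neg (Ne.symm hf), if_neg hf]
    push_cast
    field_simp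
    ring

end Kernel2

/-! ## §5 Face-supported data: the window holds one point -/

section Face

/-- [folklore] In the window `0 ≤ n < 2L`: `n % L = L − 1 ↔ n = L − 1 ∨ n = 2L − 1`. -/
theorem emod_window {L : ℤ} {n : ℤ} (h0 : 0 ≤ n) (h2 : n < 2 * L) : n % L = L - 1 ↔ (n = L - 1 ∨ n = 2 * L - 1) := by
  by_cases hn : n < L
  · rw [Int.emod_eq_of_lt h0 hn]
    constructor
    · intro h; exact Or.inl h
    · rintro (h | h) <;> omega
  · push Not at hn
    have e : n % L = n - L := by
      rw [show n = (n - L) + L by ring, Int.add_emod_right, Int.emod_eq_of_lt (by omega) (by omega)]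
      ring
    rw [e]
    constructor
    · intro h; exact Or.inr (by omega)
    · rintro (h | h) <;> omega

/-- [folklore] **A FACE-SUPPORTED PROFILE HAS ONE POINT IN EVERY WINDOW OF LENGTH `L`** starting at `L·c + r₀`, `r₀ < L`:
`Σ_{k<L} g(L·c + r₀ + k) = g(L·c + (L − 1))`. -/
theorem sum_range_face {L : ℕ} (hL : 1 ≤ L) {r₀ : ℕ} (hr₀ : r₀ < L) (g : ℤ → ℝ) (hg : ∀ n : ℤ, n % (L : ℤ) ≠ (L : ℤ) - 1 → g n = 0) (c : ℤ) :
    ∑ k ∈ Finset.range L, g ((L : ℤ) * c + (r₀ : ℤ) + (k : ℤ)) = g ((L : ℤ) * c + ((L : ℤ) - 1)) := by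
  have hL' : (0 : ℤ) < (L : ℤ) := by exact_mod_cast hL
  rw [Finset.sum_eq_single (L - 1 - r₀)]
  · congr 1
    push_cast [Nat.sub_sub, Nat.cast_sub (by omega : 1 + r₀ ≤ L)]
    ring
  · intro k hk hne
    apply hg
    rw [Finset.mem_range] at hk
    have e : ((L : ℤ) * c + (r₀ : ℤ) + (k : ℤ)) % (L : ℤ) = ((r₀ : ℤ) + (k : ℤ)) % (L : ℤ) := by
      rw [show (L : ℤ) * c + (r₀ : ℤ) + (k : ℤ) = ((r₀ : ℤ) + (k : ℤ)) + (L : ℤ) * c by ring, Int.add_mul_emod_self_left]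
    rw [e, Ne, emod_window (by positivity) (by omega)]
    push Not
    constructor <;> omega
  · intro h
    exact absurd (Finset.mem_range.2 (by omega)) h

/-- [folklore] **THE SYMMETRISED BORDER KERNEL AGAINST TWO FACE-SUPPORTED SINGLE-COORDINATE DATA VANISHES** (finite form on the support box):
`Σ_{q,u ∈ nearBox L y} h(q_β)s(u_ν)·(m^ρ_{(m,y)}((β,q),(ν,u)) + m^ρ_{(m,y)}((ν,u),(β,q))) = 0`. -/
theorem sum_nearBox_vhKerAt_symm_eq_zero {L : ℕ} (hL : 1 ≤ L) {r : Fin (d + 1) → ℕ} (hr : r ∈ box (d + 1) L) (β ν m : Fin (d + 1))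
    (y : Site (d + 1)) {h s : ℤ → ℝ} (hh : ∀ n : ℤ, n % (L : ℤ) ≠ (L : ℤ) - 1 → h n = 0) (hs : ∀ n : ℤ, n % (L : ℤ) ≠ (L : ℤ) - 1 → s n = 0) :
    ∑ q ∈ nearBox L y, ∑ u ∈ nearBox L y, h (q β) * s (u ν) *
      (vhKerAt (toSite r) L m y (β, q) (ν, u) + vhKerAt (toSite r) L m y (ν, u) (β, q)) = 0 := by
  classical
  have hrm : ∀ i, r i < L := by simpa [AffineAveraging.box, Fintype.mem_piFinset, Finset.mem_range] using hr
  simp_rw [vhKerAt_add_swap hL, mul_sub, Finset.sum_sub_distrib]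
  -- the diagonal term
  have hdiag : ∑ q ∈ nearBox L y, ∑ u ∈ nearBox L y, h (q β) * s (u ν) * (if ((β, q) : Bond (d + 1)) = (ν, u) then linKerAt (toSite r) L m y (β, q) else 0) =
      if β = ν then ∑ q ∈ nearBox L y, (h (q β) * s (q β)) * linKerAt (toSite r) L m y (β, q) else 0 := by
    by_cases hβν : β = ν
    · subst hβν
      rw [if_pos rfl]
      refine Finset.sum_congr rfl fun q hq => ?_
      rw [Finset.sum_eq_single q]
      · simp
      · intro u _ hu
        rw [if_neg fun e => hu ((Prod.mk.injEq _ _ _ _).mp e).2.symm, mul_zero]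
      · intro hq'; exact absurd hq hq'
    · rw [if_neg hβν]
      refine Finset.sum_eq_zero fun q _ => Finset.sum_eq_zero fun u _ => ?_
      rw [if_neg fun e => hβν ((Prod.mk.injEq _ _ _ _).mp e).1, mul_zero]
  -- the product term
  have hprod : ∑ q ∈ nearBox L y, ∑ u ∈ nearBox L y, h (q β) * s (u ν) * (linKerAt (toSite r) L m y (β, q) * linKerAt (toSite r) L m y (ν, u)) =
      (∑ q ∈ nearBox L y, h (q β) * linKerAt (toSite r) L m y (β, q)) * ∑ u ∈ nearBox L y, s (u ν) * linKerAt (toSite r) L m y (ν, u) := by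
    rw [Finset.sum_mul_sum]
    exact Finset.sum_congr rfl fun q _ => Finset.sum_congr rfl fun u _ => by ring
  rw [hdiag, hprod, sum_nearBox_mul_linKerAt hL hr h β m y, sum_nearBox_mul_linKerAt hL hr s ν m y]
  by_cases hβν : β = ν
  · subst hβν
    rw [if_pos rfl, sum_nearBox_mul_linKerAt hL hr (fun n => h n * s n) β m y]
    by_cases hβm : β = m
    · subst hβm
      simp only [if_true]
      have e3 := sum_range_face hL (hrm β) (fun n => h n * s n) (fun n hn => by simp [hh n hn]) (y β)
      rw [e3, sum_range_face hL (hrm β) h hh (y β), sum_range_face hL (hrm β) s hs (y β), sub_self]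
    · simp only [if_neg hβm, zero_mul, sub_self]
  · rw [if_neg hβν]
    by_cases hβm : β = m
    · subst hβm
      rw [if_pos rfl, if_neg (Ne.symm hβν), mul_zero, sub_self]
    · rw [if_neg hβm, zero_mul, sub_self]

end Face

/-! ## §6 The letter -/

section Letter

/-- [folklore] **THE VH LETTER (weighted leg first, free leg second)**: for exit-face-supported single-coordinate data `h` (direction `β`) and `s` (direction `ν`), `1 ≤ L`, in-block root
`r ∈ box L`, every free leg `(p, a)`:
`Σ'_q h(q_β)·Σ'_u s(u_ν)·vhSAt ρ d L ν u q p (inl β) a + Σ'_q s(q_ν)·Σ'_u h(u_β)·vhSAt ρ d L β u q p (inl ν) a = 0`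
(field free legs: no ff block; multiplier free leg `(p, inr m)`, `p` coarse: the symmetrised border kernel of the coarse bond `(m, p∕L)`, §5). -/
theorem vhSAt_classCurrent_add_swap_eq_zero {L : ℕ} (hL : 1 ≤ L) {r : Fin (d + 1) → ℕ} (hr : r ∈ box (d + 1) L) (ν β : Fin (d + 1))
    {h s : ℤ → ℝ} (hh : ∀ n : ℤ, n % (L : ℤ) ≠ (L : ℤ) - 1 → h n = 0) (hs : ∀ n : ℤ, n % (L : ℤ) ≠ (L : ℤ) - 1 → s n = 0)
    (p : Site (d + 1)) (a : Fib d) :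
    (∑' q : Site (d + 1), h (q β) * ∑' u : Site (d + 1), s (u ν) * vhSAt (toSite r) d L rfl ν u q p (Sum.inl β) a) +
      ∑' q : Site (d + 1), s (q ν) * ∑' u : Site (d + 1), h (u β) * vhSAt (toSite r) d L rfl β u q p (Sum.inl ν) a = 0 := by
  classical
  rcases a with α | m
  · simp [vhSAt]
  · by_cases hp : off L p = 0
    · simp only [vhSAt, packVH_inl_inr, if_pos hp]
      set y := blk L p with hy
      -- both double `tsum`s are finite sums over the support box
      have hin : ∀ (g : ℤ → ℝ) (κ κ' : Fin (d + 1)) (q : Site (d + 1)),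
          ∑' u : Site (d + 1), g (u κ) * vhKerAt (toSite r) L m y (κ', q) (κ, u) = ∑ u ∈ nearBox L y, g (u κ) * vhKerAt (toSite r) L m y (κ', q) (κ, u) := by
        intro g κ κ' q
        refine tsum_eq_sum fun u hu => ?_
        rw [vhKerAt_eq_zero_right hr _ (f' := (κ, u)) (fun hn => hu (mem_nearBox.2 hn)), mul_zero]
      have hout : ∀ (g g' : ℤ → ℝ) (κ κ' : Fin (d + 1)),
          ∑' q : Site (d + 1), g' (q κ') * ∑ u ∈ nearBox L y, g (u κ) * vhKerAt (toSite r) L m y (κ', q) (κ, u) =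
            ∑ q ∈ nearBox L y, g' (q κ') * ∑ u ∈ nearBox L y, g (u κ) * vhKerAt (toSite r) L m y (κ', q) (κ, u) := by
        intro g g' κ κ'
        refine tsum_eq_sum fun q hq => ?_
        rw [Finset.sum_eq_zero fun u _ => by rw [vhKerAt_eq_zero_left hr (f := (κ', q)) (fun hn => hq (mem_nearBox.2 hn)), mul_zero], mul_zero]
      simp_rw [hin]
      rw [hout s h ν β, hout h s β ν]
      simp_rw [Finset.mul_sum]
      rw [Finset.sum_comm (s := nearBox L y) (t := nearBox L y) (f := fun q u => s (q ν) * (h (u β) * vhKerAt (toSite r) L m y (ν, q) (β, u))),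
        ← Finset.sum_add_distrib]
      simp_rw [← Finset.sum_add_distrib]
      rw [← sum_nearBox_vhKerAt_symm_eq_zero hL hr β ν m y hh hs]
      exact Finset.sum_congr rfl fun q _ => Finset.sum_congr rfl fun u _ => by ring
    · simp only [vhSAt, packVH_inl_inr, if_neg hp, mul_zero, tsum_zero, add_zero]

/-- [folklore] **THE VH LETTER (free leg first, weighted leg second)** — `vhSAt` is symmetric (`vhSAt_symm`). -/
theorem vhSAt_classCurrent_add_swap_eq_zero' {L : ℕ} (hL : 1 ≤ L) {r : Fin (d + 1) → ℕ} (hr : r ∈ box (d + 1) L) (ν β : Fin (d + 1))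
    {h s : ℤ → ℝ} (hh : ∀ n : ℤ, n % (L : ℤ) ≠ (L : ℤ) - 1 → h n = 0) (hs : ∀ n : ℤ, n % (L : ℤ) ≠ (L : ℤ) - 1 → s n = 0)
    (p : Site (d + 1)) (a : Fib d) :
    (∑' q : Site (d + 1), h (q β) * ∑' u : Site (d + 1), s (u ν) * vhSAt (toSite r) d L rfl ν u p q a (Sum.inl β)) +
      ∑' q : Site (d + 1), s (q ν) * ∑' u : Site (d + 1), h (u β) * vhSAt (toSite r) d L rfl β u p q a (Sum.inl ν) = 0 := by
  have e : ∀ (κ τ : Fin (d + 1)) (u q : Site (d + 1)), vhSAt (toSite r) d L rfl κ u p q a (Sum.inl τ) = vhSAt (toSite r) d L rfl κ u q p (Sum.inl τ) a :=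
    fun κ τ u q => vhSAt_symm (toSite r) L κ u p q a (Sum.inl τ)
  simp_rw [e]
  exact vhSAt_classCurrent_add_swap_eq_zero hL hr ν β hh hs p a

end Letter

end Summit.QuantumFields.BalabanUV.Beta.GAN24.VHClassCurrentSym

end
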